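import Summits.QuantumFields.BalabanUV.Beta.D1BFx.ScaledWindowCount

/-!
# `BalabanUV.Beta.D1BFx.FlatGradedCount` — road «BF-x» for binder row D1, leaf A3.c: THE «FLAT × GRADED» CLASS OF REST TERMS
# a bubble term one of whose two factors is FLAT AT THE BLOCK SCALE (`|F w| ≤ C/n^a` on the window `‖w‖∞ ≤ n`) and the other
# GRADED (`|G w| ≤ A/‖w‖∞^b`), with `a + b ≥ 6` (`a ≥ 1`), carries the (1.22) moment weight `w_μ w_ν` INTO the scaled window
# hypothesis of `ScaledWindowCount` (`p = 1`, constant `C·A`) — hence its full lattice sum is `≤ 80·C·A + 80·E·(1 + 1/δ)`,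
# UNIFORMLY IN THE BLOCK SIZE `n`

HONEST FRAMING (cell contract, verbatim): «discharging `BetaPertH` makes Bałaban's UV stability UNCONDITIONAL — a real constructive-QFT
result; it is NOT the continuum limit and NOT the Clay problem.»  This module is [folklore] arithmetic on `ℤ⁴` shells composed BY NAME
from the tree (`D1BFx.ScaledWindowCount.abs_fullSum_le_of_scaledWindow`, `BubbleTransfer.abs_moment_le`,
`DyadicShell.supNorm_eq_of_mem_sphere`).  It cites nothing, mints no `Prop`, discharges nothing of the wall; `F`, `G`, the table rows
`F i`, `G i` below are ARBITRARY functions `Pt → ℝ` — nothing about Bałaban's kernels is asserted.  NOT summit progress; NOT D1,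
NOT BetaPertH, NOT continuum, NOT Clay.
HONEST DEPENDENCY (verbatim): «continuum YM on T⁴ ⇐ BetaPertH ∧ nine spine estimates (0/9 proved); BetaPertH ⇐ (D1) ∧ (D4) ∧ CAP+tail;
G-an2-4 gates asym, D1 and NE2/3/4.»

WHY (skeleton `HOME/beta/skeletons/D1-b2b-balaban-beta-d1-p2.md` v1.4 node A, leaf A3.c «OFF-DIAGONAL / non-scalar leg remainder L1′
against local jets: one leg `δσ_n`, one leg `E_n = O(n⁻²)`-graded (no `gFree` part) ⇒ … ⇒ `O(1)`»; referee R67 (c2) «A1/A3 are where the road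
lives or dies»; claim table `HOME/b2b-balaban-beta-d1-p2/LEAVES-BFx.md` row A3.c, unit `b2b-balaban-beta-d1-formalise-leaf-08`).
In the one-loop expansion at block size `n` (d = 4), a REST term of type A3.c is a product of
* a factor FLAT at the block scale — the off-diagonal entries of the infinite-volume gluon propagator (`VectorPropagatorLimit.Kinf`,
  `κ ≠ λ`: pure line 3 of Bałaban's (1.83), `Kinf_of_ne`) and their lattice differences have, on `ℤ⁴` and in lattice units (the
  factor `n²` of `Kinf` over the torus-level `LongitudinalWindow` grades `C_i/n^{4+i}`), the WINDOW GRADE `C₀/n²`, `C₁/n³` (one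
  difference at either end), `C₂/n⁴` (one difference at each end), constants `ellD0/ellD1/ellD2 4 a` — packaged as
  `D1BFx.OffDiagonalLegGrade.abs_Kinf_offDiag_le_four` / `_sub_base_le_four` / `_sub_disp_le_four` / `_sub_sub_le_four` (part 2 of this
  leaf), i.e. `|F w| ≤ C/n^a` with `a = 2 + (number of differences on this factor)`;
* a GRADED factor — a `BubbleTransfer.Leg`-class local factor `|G w| ≤ A/‖w‖∞^b`, `b = 2 + (number of differences on it)`
  (`Leg.abs_f_le` shape);
with two differences in total (at most one at each end of each leg), so `a + b = 6` exactly; the doubly-flat term (both factors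
off-diagonal) has `a = 6`, `b = 0`.  With the moment weight `|w_μ w_ν| ≤ ‖w‖∞²` the term is `≤ C·A·(r+1)^{2−b}/n^a ≤ C·A/((r+1)³·n)` on
the shell `‖w‖∞ = r+1 ≤ n` — the `p = 1` window hypothesis of `abs_fullSum_le_of_scaledWindow` (these terms are in fact `p = a`-class;
`p = 1` is all the counting needs).  [v1.1 DOCFIX: v1 of this paragraph mis-stated the flat grade as `C₀/n⁴, C₁/n⁵, C₂/n⁶`, `a = 4 + #`,
`a + b = 8` — the torus-level exponents without the `n²` of lattice units; the theorems below, stated for general `1 ≤ a`, `6 ≤ a + b`,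
are byte-identical to v1 and were never affected.]
WHAT IS NOT DONE HERE (recorded, not hidden): which jets hit which leg is node A0's term list (after the typer's T4–T7); and the
scale-`n` exponential TAIL of such a term beyond the window is the hypothesis `htail` below (for line 3 it is the cited, unproved
[Balaban1984PropagatorsI] Prop. 1.2 (1.110) tail — per `LongitudinalWindow`'s header, NOT certified in the tree).

CONTENT (all [folklore]).
* `pow_five_mul_le` — the exponent bookkeeping `(r+1)⁵·n ≤ (r+1)^b·n^a` for `r + 1 ≤ n`, `1 ≤ n`, `1 ≤ a`, `6 ≤ a + b` (ℕ, then cast).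
* `abs_weighted_flatGraded_le` — ONE POINT of the shell `‖w‖∞ = r+1 ≤ n`: `|w_μ w_ν·(F w·G w)| ≤ C·A/((r+1)³·n)`.
* `abs_fullSum_le_of_flatGraded` — window + tail ⇒ `|fullSum (w ↦ w_μ w_ν·F w·G w)| ≤ 80·C·A + 80·E·(1 + 1/δ)`, `n`-free.
* `abs_weighted_flatGradedTable_le`, `abs_fullSum_le_of_flatGradedTable` — the same for a finite TABLE `Σ_i c_i·F_i·G_i` of such
  products (constant `Σ_i |c_i|·C_i·A_i`, written inline — no `def`), the shape in which node A0's term list will deliver the A3.c class.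
-/

namespace Summit.QuantumFields.BalabanUV.Beta.D1BFx.FlatGradedCount

open Finset
open scoped BigOperators
open Literature.Probability.LatticeModels (annulus)
open Literature.MathematicalPhysics.QuantumFieldTheory.Balaban1983to89
open Literature.MathematicalPhysics.QuantumFieldTheory.Balaban1983to89.Beta
open DyadicShell (Pt toReal supNorm supNorm_eq_of_mem_sphere)
open BubbleTransfer (abs_moment_le)
open WindowIdentification (fullSum)
open ScaledWindowCount (abs_fullSum_le_of_scaledWindow)

/-! ## 1. Exponent bookkeeping -/

/-- [folklore] `(r+1)⁵·n ≤ (r+1)^b·n^a` in `ℕ` for `r + 1 ≤ n`, `1 ≤ n`, `1 ≤ a`, `6 ≤ a + b`: if `b ≤ 5`, trade the `5 − b` surplus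
powers of `r + 1` for powers of `n` (`6 − b ≤ a`); if `b > 5`, `(r+1)⁵ ≤ (r+1)^b` and `n ≤ n^a`. -/
theorem pow_five_mul_le_nat {r n a b : ℕ} (hn : 1 ≤ n) (ha : 1 ≤ a) (hab : 6 ≤ a + b) (hr : r + 1 ≤ n) :
    (r + 1) ^ 5 * n ≤ (r + 1) ^ b * n ^ a := by
  have hr1 : 1 ≤ r + 1 := Nat.succ_le_succ (Nat.zero_le r)
  by_cases hb : b ≤ 5
  · have h1 : (r + 1) ^ 5 * n = (r + 1) ^ b * ((r + 1) ^ (5 - b) * n) := by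
      rw [← mul_assoc, ← pow_add, Nat.add_sub_cancel' hb]
    rw [h1]
    apply Nat.mul_le_mul_left
    calc (r + 1) ^ (5 - b) * n ≤ n ^ (5 - b) * n := Nat.mul_le_mul_right _ (Nat.pow_le_pow_left hr _)
      _ = n ^ (6 - b) := by
          rw [← pow_succ]
          congr 1
          omega
      _ ≤ n ^ a := Nat.pow_le_pow_right hn (by omega)
  · have hb' : 5 ≤ b := (not_le.mp hb).le
    calc (r + 1) ^ 5 * n ≤ (r + 1) ^ b * n := Nat.mul_le_mul_right _ (Nat.pow_le_pow_right hr1 hb')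
      _ ≤ (r + 1) ^ b * n ^ a := by
          apply Nat.mul_le_mul_left
          calc n = n ^ 1 := (pow_one n).symm
            _ ≤ n ^ a := Nat.pow_le_pow_right hn ha

/-- [folklore] The same inequality over `ℝ`. -/
theorem pow_five_mul_le {r n a b : ℕ} (hn : 1 ≤ n) (ha : 1 ≤ a) (hab : 6 ≤ a + b) (hr : r + 1 ≤ n) :
    ((r : ℝ) + 1) ^ 5 * (n : ℝ) ≤ ((r : ℝ) + 1) ^ b * (n : ℝ) ^ a := by
  have h := pow_five_mul_le_nat hn ha hab hr
  exact_mod_cast h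

/-! ## 2. One point of the shell: the «flat × graded» product lands in the `p = 1` scaled window class -/

/-- [folklore] **ONE POINT.**  On the shell `‖w‖∞ = r + 1 ≤ n`: a flat factor `|F w| ≤ C/n^a` times a graded factor `|G w| ≤ A/(r+1)^b`,
`1 ≤ a`, `6 ≤ a + b`, times the moment weight `w_μ w_ν`, is `≤ C·A/((r+1)³·n)` — the `p = 1` scaled window bound of
`ScaledWindowCount` with constant `C·A` (written in that theorem's literal shape, `(r+1)^(1-1)` included). -/
theorem abs_weighted_flatGraded_le {F G : Pt → ℝ} {n a b : ℕ} (hn : 1 ≤ n) (ha : 1 ≤ a) (hab : 6 ≤ a + b) {C A : ℝ}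
    (hC : 0 ≤ C) (hA : 0 ≤ A) (μ ν : Fin 4) {r : ℕ} (hr : r + 1 ≤ n) {w : Pt} (hw : w ∈ annulus 4 r (r + 1))
    (hF : |F w| ≤ C / (n : ℝ) ^ a) (hG : |G w| ≤ A / ((r : ℝ) + 1) ^ b) :
    |toReal w μ * toReal w ν * (F w * G w)| ≤ C * A * ((r : ℝ) + 1) ^ (1 - 1) / (((r : ℝ) + 1) ^ 3 * (n : ℝ) ^ 1) := by
  have hr0 : (0 : ℝ) < (r : ℝ) + 1 := by positivity
  have hn0 : (0 : ℝ) < (n : ℝ) := by exact_mod_cast hn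
  have hsup : (supNorm w : ℝ) = (r : ℝ) + 1 := by rw [supNorm_eq_of_mem_sphere hw]; push_cast; ring
  have hmom : |toReal w μ * toReal w ν| ≤ ((r : ℝ) + 1) ^ 2 := by rw [← hsup]; exact abs_moment_le μ ν w
  have hkey := pow_five_mul_le (b := b) hn ha hab hr
  rw [Nat.sub_self, pow_zero, mul_one, pow_one, abs_mul (toReal w μ * toReal w ν), abs_mul (F w)]
  calc |toReal w μ * toReal w ν| * (|F w| * |G w|)
      ≤ ((r : ℝ) + 1) ^ 2 * (C / (n : ℝ) ^ a * (A / ((r : ℝ) + 1) ^ b)) := by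
        apply mul_le_mul hmom (mul_le_mul hF hG (abs_nonneg _) (by positivity)) (by positivity) (by positivity)
    _ = C * A * (((r : ℝ) + 1) ^ 2 / ((n : ℝ) ^ a * ((r : ℝ) + 1) ^ b)) := by
        field_simp
    _ ≤ C * A * (1 / (((r : ℝ) + 1) ^ 3 * (n : ℝ))) := by
        apply mul_le_mul_of_nonneg_left _ (by positivity)
        rw [div_le_div_iff₀ (by positivity) (by positivity)]
        calc ((r : ℝ) + 1) ^ 2 * (((r : ℝ) + 1) ^ 3 * (n : ℝ)) = ((r : ℝ) + 1) ^ 5 * (n : ℝ) := by ring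
          _ ≤ ((r : ℝ) + 1) ^ b * (n : ℝ) ^ a := hkey
          _ = 1 * ((n : ℝ) ^ a * ((r : ℝ) + 1) ^ b) := by ring
    _ = C * A / (((r : ℝ) + 1) ^ 3 * (n : ℝ)) := by rw [mul_one_div]

/-! ## 3. Window + tail: the full lattice sum of a «flat × graded» term is bounded uniformly in the block size -/

/-- [folklore] **THE A3.c CLASS IS `O(1)` UNIFORMLY IN `n`.**  If on every shell `‖w‖∞ = r+1 ≤ n` the factor `F` is flat, `|F w| ≤ C/n^a`,
and the factor `G` graded, `|G w| ≤ A/(r+1)^b`, with `1 ≤ a`, `6 ≤ a + b`, and if from the shell `r ≥ n − 1` on the weighted product has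
the standard scale-`n` massive tail `E/(r+1)⁴·e^{−(δ/n)(r+1)}`, then `|fullSum (w ↦ w_μ w_ν·F w·G w)| ≤ 80·C·A + 80·E·(1 + 1/δ)` —
INDEPENDENT OF `n` (`ScaledWindowCount.abs_fullSum_le_of_scaledWindow` at `p = 1`). -/
theorem abs_fullSum_le_of_flatGraded {F G : Pt → ℝ} {n a b : ℕ} (hn : 1 ≤ n) (ha : 1 ≤ a) (hab : 6 ≤ a + b) {C A E δ : ℝ}
    (hC : 0 ≤ C) (hA : 0 ≤ A) (hE : 0 ≤ E) (hδ : 0 < δ) (μ ν : Fin 4)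
    (hF : ∀ r : ℕ, r + 1 ≤ n → ∀ w ∈ annulus 4 r (r + 1), |F w| ≤ C / (n : ℝ) ^ a)
    (hG : ∀ r : ℕ, r + 1 ≤ n → ∀ w ∈ annulus 4 r (r + 1), |G w| ≤ A / ((r : ℝ) + 1) ^ b)
    (htail : ∀ r : ℕ, n - 1 ≤ r → ∀ w ∈ annulus 4 r (r + 1),
      |toReal w μ * toReal w ν * (F w * G w)| ≤ E / ((r : ℝ) + 1) ^ 4 * Real.exp (-(δ / (n : ℝ)) * ((r : ℝ) + 1))) :
    |fullSum (fun w => toReal w μ * toReal w ν * (F w * G w))| ≤ 80 * (C * A) + 80 * E * (1 + 1 / δ) :=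
  abs_fullSum_le_of_scaledWindow (K := fun w => toReal w μ * toReal w ν * (F w * G w)) (p := 1) hn le_rfl
    (mul_nonneg hC hA) hE hδ
    (fun r hr w hw => abs_weighted_flatGraded_le hn ha hab hC hA μ ν hr hw (hF r hr w hw) (hG r hr w hw)) htail

/-! ## 4. The same for a finite TABLE of «flat × graded» products -/

section Table

variable {ι : Type*} {s : Finset ι} {c : ι → ℝ} {F G : ι → Pt → ℝ}

/-- [folklore] **ONE POINT, TABLE FORM.**  On the shell `‖w‖∞ = r + 1 ≤ n`, if every row `i ∈ s` of the lattice table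
`Σ_{i ∈ s} c_i·F_i(w)·G_i(w)` is flat × graded with exponents `1 ≤ a_i`, `6 ≤ a_i + b_i` and constants `C_i, A_i ≥ 0`, then
`|w_μ w_ν·Σ_i c_i F_i G_i| ≤ (Σ_i |c_i| C_i A_i)/((r+1)³·n)` — the `p = 1` scaled window bound with the `n`-free table constant
`Σ_{i ∈ s} |c_i|·C_i·A_i`. -/
theorem abs_weighted_flatGradedTable_le {n : ℕ} {a b : ι → ℕ} (hn : 1 ≤ n) (ha : ∀ i ∈ s, 1 ≤ a i) (hab : ∀ i ∈ s, 6 ≤ a i + b i)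
    {C A : ι → ℝ} (hC : ∀ i ∈ s, 0 ≤ C i) (hA : ∀ i ∈ s, 0 ≤ A i) (μ ν : Fin 4) {r : ℕ} (hr : r + 1 ≤ n) {w : Pt}
    (hw : w ∈ annulus 4 r (r + 1)) (hF : ∀ i ∈ s, |F i w| ≤ C i / (n : ℝ) ^ a i) (hG : ∀ i ∈ s, |G i w| ≤ A i / ((r : ℝ) + 1) ^ b i) :
    |toReal w μ * toReal w ν * ∑ i ∈ s, c i * (F i w * G i w)| ≤
      (∑ i ∈ s, |c i| * (C i * A i)) * ((r : ℝ) + 1) ^ (1 - 1) / (((r : ℝ) + 1) ^ 3 * (n : ℝ) ^ 1) := by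
  rw [Finset.mul_sum, Finset.sum_mul, Finset.sum_div]
  refine (Finset.abs_sum_le_sum_abs _ _).trans (Finset.sum_le_sum fun i hi => ?_)
  have h1 := abs_weighted_flatGraded_le (F := F i) (G := G i) hn (ha i hi) (hab i hi) (hC i hi) (hA i hi) μ ν hr hw (hF i hi) (hG i hi)
  have e : toReal w μ * toReal w ν * (c i * (F i w * G i w)) = c i * (toReal w μ * toReal w ν * (F i w * G i w)) := by ring
  rw [e, abs_mul]
  calc |c i| * |toReal w μ * toReal w ν * (F i w * G i w)|
      ≤ |c i| * (C i * A i * ((r : ℝ) + 1) ^ (1 - 1) / (((r : ℝ) + 1) ^ 3 * (n : ℝ) ^ 1)) :=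
        mul_le_mul_of_nonneg_left h1 (abs_nonneg _)
    _ = |c i| * (C i * A i) * ((r : ℝ) + 1) ^ (1 - 1) / (((r : ℝ) + 1) ^ 3 * (n : ℝ) ^ 1) := by ring

/-- [folklore] **THE A3.c CLASS IS `O(1)` UNIFORMLY IN `n`, TABLE FORM.**  A finite table `Σ_{i ∈ s} c_i·F_i·G_i` of flat × graded
products (rowwise `|F_i w| ≤ C_i/n^{a_i}`, `|G_i w| ≤ A_i/(r+1)^{b_i}` on the shells `r + 1 ≤ n`, `1 ≤ a_i`, `6 ≤ a_i + b_i`) whose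
weighted sum has the standard scale-`n` massive tail from the shell `r ≥ n − 1` on satisfies
`|fullSum (w ↦ w_μ w_ν·Σ_i c_i F_i(w) G_i(w))| ≤ 80·(Σ_i |c_i| C_i A_i) + 80·E·(1 + 1/δ)` — INDEPENDENT OF `n`. -/
theorem abs_fullSum_le_of_flatGradedTable {n : ℕ} {a b : ι → ℕ} (hn : 1 ≤ n) (ha : ∀ i ∈ s, 1 ≤ a i)
    (hab : ∀ i ∈ s, 6 ≤ a i + b i) {C A : ι → ℝ} {E δ : ℝ} (hC : ∀ i ∈ s, 0 ≤ C i) (hA : ∀ i ∈ s, 0 ≤ A i) (hE : 0 ≤ E)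
    (hδ : 0 < δ) (μ ν : Fin 4)
    (hF : ∀ r : ℕ, r + 1 ≤ n → ∀ w ∈ annulus 4 r (r + 1), ∀ i ∈ s, |F i w| ≤ C i / (n : ℝ) ^ a i)
    (hG : ∀ r : ℕ, r + 1 ≤ n → ∀ w ∈ annulus 4 r (r + 1), ∀ i ∈ s, |G i w| ≤ A i / ((r : ℝ) + 1) ^ b i)
    (htail : ∀ r : ℕ, n - 1 ≤ r → ∀ w ∈ annulus 4 r (r + 1),
      |toReal w μ * toReal w ν * ∑ i ∈ s, c i * (F i w * G i w)| ≤
        E / ((r : ℝ) + 1) ^ 4 * Real.exp (-(δ / (n : ℝ)) * ((r : ℝ) + 1))) :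
    |fullSum (fun w => toReal w μ * toReal w ν * ∑ i ∈ s, c i * (F i w * G i w))| ≤
      80 * (∑ i ∈ s, |c i| * (C i * A i)) + 80 * E * (1 + 1 / δ) :=
  abs_fullSum_le_of_scaledWindow (K := fun w => toReal w μ * toReal w ν * ∑ i ∈ s, c i * (F i w * G i w)) (p := 1) hn le_rfl
    (Finset.sum_nonneg fun i hi => mul_nonneg (abs_nonneg _) (mul_nonneg (hC i hi) (hA i hi))) hE hδ
    (fun r hr w hw => abs_weighted_flatGradedTable_le hn ha hab hC hA μ ν hr hw (hF r hr w hw) (hG r hr w hw)) htail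

end Table

end Summit.QuantumFields.BalabanUV.Beta.D1BFx.FlatGradedCount
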